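import Literature.IUT.HodgeTheaters.InitialThetaDataTorsionClaimsModelConstruction
import HarnessLib

/-!
# [IUTchI] §1 pp. 37–38 at the semidirect CLAIMS MODEL: the thirteen printed claims `ArrowCoveringClaims` HOLD, the
# monodromy kills the cusp inertia (`hI`), and the JOINT non-vacuity witness
# «∃ D, ∃ M : D.TorsionMonodromy, ArrowCoveringClaims ∧ hI» (proof-only companion, part 4b of the JOINT-NV row)

S. Mochizuki, *Inter-universal Teichmüller theory I*, kurims manuscript (May 2020), §1 p. 38 l. 13–23 «Moreover, the natural
composite maps `I_{ε̲′} ↪ Δ_ε̲ ↠ Δ⁺_ε̲`; `I_{ε̲″} ↪ Δ_ε̲ ↠ Δ⁺_ε̲` determine isomorphisms `I_{ε̲′} ⥲ Δ⁺_ε̲`, `I_{ε̲″} ⥲ Δ⁺_ε̲`»,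
l. 28–32 «where the surjections `Π_X̲ ↠ G_k`, `Π_C̲ ↠ G_k` induce natural exact sequences `1 → Δ⁺_ε̲ → J_X̲ → G_k → 1`,
`1 → Δ⁺_ε̲ × Gal(X̲/C̲) → J_C̲ → G_k → 1`; we have a natural inclusion `J_X̲ ↪ J_C̲`», l. 46–66 «Moreover, by considering the
decomposition groups associated to the cusps of `X̲` lying over `2ε̲`, we conclude that `Im(σ)` lies inside the subgroup
`J_X̲ ⊆ J_C̲`. Thus, the subgroups `Im(σ) ⊆ J_X̲`, `Im(σ) × Gal(X̲/C̲) ⊆ J_C̲` determine [the horizontal arrows in] cartesian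
diagrams … of finite étale cyclic coverings of hyperbolic orbicurves and open immersions [with normal image] of profinite
groups; we have `Gal(C̲→/C̲) ≅ ℤ/lℤ`, `Gal(X̲/C̲) ≅ ℤ/2ℤ`, and `Gal(X̲→/C̲) ⥲ Gal(X̲/C̲) × Gal(C̲→/C̲) ≅ ℤ/2lℤ`» (the «…»
elides the three displayed squares `X̲→ → X̲ / C̲→ → C̲`, `Π_{X̲→} → Π_X̲ / Π_{C̲→} → Π_C̲`, `Δ_{X̲→} → Δ_X̲ / Δ_{C̲→} → Δ_C̲`;
OUR interface's open subgroup `Π_{X̲→} ⊆ Π_X̲` (abc-iut-L5-t1's `ArrowCoveringClaims`) is the inverse image of `Im(σ)`)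
([IUTchI] §1 p.38) [claim: Mochizuki2012, status: disputed] (D-0012 claim key; series status DISPUTED — theorems about a
MODEL of the cell's `π₁`-interface structures; nothing of the series is asserted; no side taken on [IUTchIII] Cor. 3.12).
(Doc-only v2: the §1 p. 38 quotations re-cut VERBATIM, with line locators, from the render of record
`HOME/lit/renders/IUTchI-kurims-url-690e7b3c6199` (underlines by `ruleattr.py`) — referee abc-iut-ref-m M20-F4; all
declarations byte-identical to p454043.)

## WHAT (proof-only; 0 definitions)

`arrowCoveringClaims_pedOf` — ALL THIRTEEN printed claims of abc-iut-L5-t1's `ArrowCoveringClaims` at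
`TorsionClaimsModel.pedOf G g h5 h6` (`l ≥ 5` prime, `#E_F[l](F̄) = l²`, `g ≠ 1`): `jKer ⊴ Π_{C̲}`, `[Δ_X̲ : jKer] = l`,
`I_{ε′} ⊔ jKer = Δ_X̲ = I_{ε″} ⊔ jKer` (NONTRIVIAL inertia supplying the inertia line, `jKer` the rest), `Π_{X→} ∩ Δ_C =
jKer`, `Π_{X→} ↠ G`, the cartesian square `Π_{X→} = Π_X̲ ∩ Π_{C→}`, normality of `Π_{X→}, Π_{C→}` in `Π_C̲`, `[Π_C̲ :
Π_{X→}] = 2l`, `[Π_C̲ : Π_{C→}] = l`, and the cyclic quotients `W × {±1} ≅ ℤ/2l`, `W ≅ ℤ/l`.  At the re-geometrised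
initial Θ-datum: `arrowCoveringClaims_regeom₂`, `inertia_ε1_regeom₂_ne_bot`, `tau_inertia_regeom₂` / `hI_regeom₂` (the
monodromy `τ = pr_{E[l]}` of part 3 kills `embK(I_x)` for every cusp label), and the JOINT witness
**`exists_torsionMonodromy_arrowCoveringClaims_hI`** — the binder SET `{M, hA, hI}` of abc-iut-L5-d5's derived local arrow
law (`localArrowLaw_local_of_torsionMonodromy`, p446888) and of abc-iut-L5-t4's `baseKitOfTorsionMonodromy` (p446463) is
JOINTLY INHABITED at ONE datum (previously: `M` at abc-iut-L5-t8's `regeom` NV #45, `hA` at abc-iut-L5-t1-lineage's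
`pedClaimsOf`, `hI` at `regeom` [degenerate, p447268] — and `regeom` refutes `hA`, `not_arrowCoveringClaims_regeom`).

STATUS OF THE OTHER CONSUMER INPUTS AT THIS MODEL (abc-iut-L5-lead RULINGS #68 ask (b)): `CG : CuspGalois` (cusp-Galois
data: needs `l` cusp labels with pairwise non-conjugate decomposition groups) is NOT inhabited at this 4-label model with
`D_{ε⁰} = D_{ε′} = D_{ε″}`; `hS : CuspClassesNormaliserStable` and the `PMBaseKit` corollary (ask (a)) are not treated in
this file.  So every conclusion that takes `CG` (e.g. `LocalArrowLaw CG hS H` itself) stays relative to `CG`; what is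
certified here is the joint satisfiability of the three binders `{M, hA, hI}` that the derived Λ consumes.

HONEST LABEL.  Joint non-vacuity of OUR typed binders at a MODEL «[synthetic rank-1 inertia line, ι-fixed, I_{ε′} =
I_{ε″}; finite Δ_X; genuine Galois action on E_F[l]]»; says nothing about the genuine `π₁`.  Typed ≠ inhabited ≠
discharged; instantiated ≠ endorsed; no side taken on [IUTchIII] Cor. 3.12.
-/

noncomputable section

namespace Literature.IUT.HodgeTheaters

universe u

namespace TorsionClaimsModel

open Literature.AnabelianGeometry.AbsoluteAnabelian Topology
open TorsionMonodromyModel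
open scoped WeierstrassCurve.Affine Classical

variable {F : Type u} [Field F] {E : WeierstrassCurve F} {Fbar : Type u} [Field Fbar] [Algebra F Fbar] {l : ℕ}

section Claims

variable (G : Type u) [Group G] [TopologicalSpace G] [IsTopologicalGroup G] [CompactSpace G]
  [TotallyDisconnectedSpace G] [E.IsElliptic] [NeZero l] (g : Tors E Fbar l) (h5 : 5 ≤ l) (h6 : l.Coprime 6)

/-- The inertia line is NONTRIVIAL: `inr (inl (w₀, 1)) ∈ I_{ε′}` with `w₀ = 1 ∈ ℤ/l`, `≠ 1`.
[cite: Mochizuki2012, IUTchI §1 p.37] -/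
theorem inertia_ε1_ne_bot (hl : l.Prime) : (pedOf G g h5 h6).inertia (pedOf G g h5 h6).ε1 ≠ ⊥ := by
  intro h
  have hmem : ((1 : G), (SemidirectProduct.inl (Multiplicative.ofAdd (1 : ZMod l), 1) : Dih E Fbar l)) ∈
      (pedOf G g h5 h6).inertia (pedOf G g h5 h6).ε1 :=
    (mem_inertia_iff_of_ne G g h5 h6 (show (⟨1⟩ : ULift.{u} (Fin 4)) ≠ ⟨3⟩ by decide)).mpr ⟨rfl, rfl, rfl⟩
  have h1 : ((1 : G), (SemidirectProduct.inl (Multiplicative.ofAdd (1 : ZMod l), 1) : Dih E Fbar l)) = 1 :=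
    Subgroup.mem_bot.mp (h.le hmem)
  have h2 := congrArg (fun z : G × Dih E Fbar l => Multiplicative.toAdd z.2.left.1) h1
  simp only [SemidirectProduct.left_inl, Prod.snd_one, SemidirectProduct.one_left, Prod.fst_one, toAdd_one,
    toAdd_ofAdd] at h2
  haveI : Fact (1 < l) := ⟨hl.one_lt⟩
  exact one_ne_zero h2

omit [E.IsElliptic] [NeZero l] in
/-- `ℤ/l × ℤ/2` is cyclic (`l` odd): the Galois group `Gal(X→/C̲) ≅ ℤ/2l` of the model. [folklore] -/
private theorem isCyclic_W_two (h6 : l.Coprime 6) : IsCyclic (Multiplicative (ZMod l) × Multiplicative (ZMod 2)) := by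
  rw [Group.isCyclic_prod_iff]
  refine ⟨inferInstance, inferInstance, ?_⟩
  rw [Nat.card_congr Multiplicative.toAdd, Nat.card_zmod, Nat.card_congr Multiplicative.toAdd, Nat.card_zmod]
  exact Nat.coprime_two_right.mpr (Nat.coprime_two_right.mp (h6.coprime_dvd_right (by norm_num)))

/-! ## The printed claims of pp. 37–38 HOLD at the model -/

/-- **The thirteen printed claims of [IUTchI] §1 pp. 37–38 hold at the claims model** `pedOf G g h5 h6` (`l ≥ 5` prime,
`#E_F[l](F̄) = l²`, `g ≠ 1`): `jKer ⊴ Π_{C̲}`, `[Δ_X̲ : jKer] = l`, `I_{ε′} ⊔ jKer = Δ_X̲ = I_{ε″} ⊔ jKer`, `Π_{X→} ∩ Δ_C = jKer`,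
`Π_{X→} ↠ G`. ([IUTchI] §1 p.38) [claim: Mochizuki2012, status: disputed] -/
theorem arrowCoveringClaims_pedOf (hl : l.Prime) (hcard : Nat.card (Tors E Fbar l) = l ^ 2) (hg : g ≠ 1) :
    (pedOf G g h5 h6).ArrowCoveringClaims where
  jKer_normal := by
    refine ⟨fun z hz p => ?_⟩
    obtain ⟨hz1, hzr, hzw, hzg⟩ := (mem_jKer_iff G g h5 h6).mp (Subgroup.mem_subgroupOf.mp hz)
    have hz2 : z.val.2 = SemidirectProduct.inl z.val.2.left := Dih.eq_inl_of_right_eq_one hzr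
    refine Subgroup.mem_subgroupOf.mpr ((mem_jKer_iff G g h5 h6).mpr ⟨?_, ?_⟩)
    · show p.val.1 * z.val.1 * p.val.1⁻¹ = 1
      rw [hz1, mul_one, mul_inv_cancel]
    · show p.val.2 * z.val.2 * p.val.2⁻¹ ∈ Dih.dLine F E g
      rw [hz2, Dih.conj_inl, sgnN_apply, hzw]
      exact ⟨SemidirectProduct.right_inl _, rfl, Subgroup.zpow_mem _ hzg _⟩
  jKer_relindex := by
    have key : ((Dih.dLine F E g).map (MonoidHom.inr G (Dih E Fbar l))).relIndex
        ((Dih.dXbar F E g).map (MonoidHom.inr G (Dih E Fbar l))) = l := by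
      rw [Subgroup.relIndex_map_map_of_injective _ _ (fun a b h => (Prod.mk.inj h).2)]
      exact Dih.dLine_relIndex_dXbar hl hcard hg
    rw [jKer_eq, DeltaXbar_eq]
    exact key
  inertia_ε1_sup := by
    refine le_antisymm (sup_le (fun z hz => ?_) (fun z hz => ?_)) (fun z hz => ?_)
    · obtain ⟨h1, h2⟩ := (mem_inertia_iff_of_ne G g h5 h6 (show (⟨1⟩ : ULift.{u} (Fin 4)) ≠ ⟨3⟩ by decide)).mp hz
      exact (mem_DeltaXbar_iff G g h5 h6).mpr ⟨h1, Dih.dW_le_dXbar g h2⟩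
    · obtain ⟨h1, h2⟩ := (mem_jKer_iff G g h5 h6).mp hz
      exact (mem_DeltaXbar_iff G g h5 h6).mpr ⟨h1, Dih.dLine_le_dXbar g h2⟩
    · obtain ⟨h1, h2⟩ := (mem_DeltaXbar_iff G g h5 h6).mp hz
      obtain ⟨hr, hg'⟩ := (Dih.mem_dXbar_iff _ _).mp h2
      -- `z = (1, inl (w, s)) = (1, inl (w, 1)) · (1, inl (1, s))`
      have hz : z = ((1 : G), (SemidirectProduct.inl (z.2.left.1, 1) : Dih E Fbar l)) *
          ((1 : G), SemidirectProduct.inl (1, z.2.left.2)) := by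
        refine Prod.ext ?_ ?_
        · show z.1 = 1 * 1
          rw [h1, mul_one]
        · show z.2 = SemidirectProduct.inl (z.2.left.1, 1) * SemidirectProduct.inl (1, z.2.left.2)
          rw [← map_mul, Prod.mk_mul_mk, mul_one, one_mul]
          exact Dih.eq_inl_of_right_eq_one hr
      rw [hz]
      refine Subgroup.mul_mem_sup ?_ ?_
      · exact (mem_inertia_iff_of_ne G g h5 h6 (show (⟨1⟩ : ULift.{u} (Fin 4)) ≠ ⟨3⟩ by decide)).mpr
          ⟨rfl, rfl, rfl⟩
      · exact (mem_jKer_iff G g h5 h6).mpr ⟨rfl, rfl, rfl, hg'⟩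
  inertia_ε2_sup := by
    have h12 : (pedOf G g h5 h6).inertia (pedOf G g h5 h6).ε2 = (pedOf G g h5 h6).inertia (pedOf G g h5 h6).ε1 := by
      rw [PuncturedEllipticData.inertia, PuncturedEllipticData.inertia, pedOf_decomp_ε1, pedOf_decomp_ε2]
    rw [h12]
    refine le_antisymm (sup_le (fun z hz => ?_) (fun z hz => ?_)) (fun z hz => ?_)
    · obtain ⟨h1, h2⟩ := (mem_inertia_iff_of_ne G g h5 h6 (show (⟨1⟩ : ULift.{u} (Fin 4)) ≠ ⟨3⟩ by decide)).mp hz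
      exact (mem_DeltaXbar_iff G g h5 h6).mpr ⟨h1, Dih.dW_le_dXbar g h2⟩
    · obtain ⟨h1, h2⟩ := (mem_jKer_iff G g h5 h6).mp hz
      exact (mem_DeltaXbar_iff G g h5 h6).mpr ⟨h1, Dih.dLine_le_dXbar g h2⟩
    · obtain ⟨h1, h2⟩ := (mem_DeltaXbar_iff G g h5 h6).mp hz
      obtain ⟨hr, hg'⟩ := (Dih.mem_dXbar_iff _ _).mp h2
      have hz : z = ((1 : G), (SemidirectProduct.inl (z.2.left.1, 1) : Dih E Fbar l)) *
          ((1 : G), SemidirectProduct.inl (1, z.2.left.2)) := by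
        refine Prod.ext ?_ ?_
        · show z.1 = 1 * 1
          rw [h1, mul_one]
        · show z.2 = SemidirectProduct.inl (z.2.left.1, 1) * SemidirectProduct.inl (1, z.2.left.2)
          rw [← map_mul, Prod.mk_mul_mk, mul_one, one_mul]
          exact Dih.eq_inl_of_right_eq_one hr
      rw [hz]
      refine Subgroup.mul_mem_sup ?_ ?_
      · exact (mem_inertia_iff_of_ne G g h5 h6 (show (⟨1⟩ : ULift.{u} (Fin 4)) ≠ ⟨3⟩ by decide)).mpr
          ⟨rfl, rfl, rfl⟩
      · exact (mem_jKer_iff G g h5 h6).mpr ⟨rfl, rfl, rfl, hg'⟩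
  piXarrow_inf_delta := by
    ext z
    constructor
    · intro h
      exact (mem_jKer_iff G g h5 h6).mpr ⟨(mem_DeltaC_iff G g h5 h6).mp h.2, (mem_piXarrow_iff G g h5 h6).mp h.1⟩
    · intro h
      obtain ⟨h1, h2⟩ := (mem_jKer_iff G g h5 h6).mp h
      exact ⟨(mem_piXarrow_iff G g h5 h6).mpr h2, (mem_DeltaC_iff G g h5 h6).mpr h1⟩
  aug_piXarrow := by
    intro σ
    refine ⟨⟨(σ, 1), (mem_piXarrow_iff G g h5 h6).mpr (one_mem _)⟩, rfl⟩
  cartesian := by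
    ext z
    constructor
    · intro hz
      obtain ⟨hr, hw, hg'⟩ := (mem_piXarrow_iff G g h5 h6).mp hz
      refine ⟨?_, (mem_piCarrow_iff G g h5 h6).mpr ((Dih.mem_dLinePM_iff _ _).mpr ⟨hg', hw⟩)⟩
      rw [pedOf_PiXbar]
      exact mem_lift.mpr ((Dih.mem_dXbar_iff _ _).mpr ⟨hr, hg'⟩)
    · rintro ⟨h1, h2⟩
      rw [pedOf_PiXbar] at h1
      obtain ⟨hr, hg'⟩ := (Dih.mem_dXbar_iff _ _).mp (mem_lift.mp h1)
      obtain ⟨-, hw⟩ := (Dih.mem_dLinePM_iff _ _).mp ((mem_piCarrow_iff G g h5 h6).mp h2)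
      exact (mem_piXarrow_iff G g h5 h6).mpr ⟨hr, hw, hg'⟩
  piXarrow_normal := by
    refine ⟨fun z hz p => ?_⟩
    obtain ⟨hzr, hzw, hzg⟩ := (mem_piXarrow_iff G g h5 h6).mp (Subgroup.mem_subgroupOf.mp hz)
    have hz2 : z.val.2 = SemidirectProduct.inl z.val.2.left := Dih.eq_inl_of_right_eq_one hzr
    refine Subgroup.mem_subgroupOf.mpr ((mem_piXarrow_iff G g h5 h6).mpr ?_)
    show p.val.2 * z.val.2 * p.val.2⁻¹ ∈ Dih.dLine F E g
    rw [hz2, Dih.conj_inl, sgnN_apply, hzw]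
    exact ⟨SemidirectProduct.right_inl _, rfl, Subgroup.zpow_mem _ hzg _⟩
  piCarrow_normal := by
    refine ⟨fun z hz p => ?_⟩
    obtain ⟨hzg, hzw⟩ := (Dih.mem_dLinePM_iff _ _).mp ((mem_piCarrow_iff G g h5 h6).mp (Subgroup.mem_subgroupOf.mp hz))
    have hp : p.val.2 ∈ Dih.dC F E g := mem_lift.mp p.property
    have hzC : z.val.2 ∈ Dih.dC F E g := (Dih.mem_dC_iff _ _).mpr hzg
    refine Subgroup.mem_subgroupOf.mpr ((mem_piCarrow_iff G g h5 h6).mpr ((Dih.mem_dLinePM_iff _ _).mpr ⟨?_, ?_⟩))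
    · show (p.val.2 * z.val.2 * p.val.2⁻¹).left.2 ∈ Subgroup.zpowers g
      exact (Dih.mem_dC_iff _ _).mp (mul_mem (mul_mem hp hzC) (inv_mem hp))
    · show (p.val.2 * z.val.2 * p.val.2⁻¹).left.1 = 1
      rw [← Dih.wCoord_apply, map_mul, map_mul, map_inv, Dih.wCoord_apply E Fbar l z.val.2, hzw, mul_one,
        mul_inv_cancel]
  piXarrow_relindex := by
    rw [piXarrow_eq]
    show (lift G (Dih.dLine F E g)).relIndex (lift G (Dih.dC F E g)) = 2 * l
    rw [lift_relIndex]
    exact Dih.dLine_relIndex_dC hl hcard hg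
  piCarrow_relindex := by
    rw [piCarrow_eq]
    show (lift G (Dih.dLinePM F E g)).relIndex (lift G (Dih.dC F E g)) = l
    rw [lift_relIndex]
    exact Dih.dLinePM_relIndex_dC hl hcard hg
  galX_cyclic := by
    intro hN
    haveI := isCyclic_W_two (l := l) h6
    -- the sign character `ℤ/2 → {±1}` (so that the cyclic source avoids the unit group's own power structure)
    let χ : Multiplicative (ZMod 2) →* ℤˣ :=
      { toFun := fun a => if a = 1 then 1 else -1
        map_one' := if_pos rfl
        map_mul' := by decide }
    have hχ : Function.Surjective χ := by
      intro u
      rcases Int.units_eq_one_or u with h | h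
      · exact ⟨1, by rw [h]; exact map_one χ⟩
      · refine ⟨Multiplicative.ofAdd 1, ?_⟩
        rw [h]
        change (if Multiplicative.ofAdd (1 : ZMod 2) = 1 then (1 : ℤˣ) else -1) = -1
        exact if_neg (by decide)
    let ψ : Multiplicative (ZMod l) × Multiplicative (ZMod 2) →* (pedOf G g h5 h6).PiCbar :=
      { toFun := fun x => ⟨((1 : G), (⟨(x.1, 1), χ x.2⟩ : Dih E Fbar l)),
          mem_lift.mpr ((Dih.mem_dC_iff _ _).mpr (one_mem _))⟩
        map_one' := by
          refine Subtype.ext (Prod.ext rfl (SemidirectProduct.ext rfl ?_))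
          show χ 1 = 1
          exact map_one χ
        map_mul' := fun x y => Subtype.ext (Prod.ext (one_mul 1).symm (SemidirectProduct.ext (by
          show ((x * y).1, (1 : Tors E Fbar l)) = (x.1, 1) * sgnN E Fbar l (χ x.2) (y.1, 1)
          rw [sgnN_apply]
          exact Prod.ext rfl
            (show (1 : Tors E Fbar l) = 1 * (1 : Tors E Fbar l) ^ ((χ x.2 : ℤˣ) : ℤ) by
              rw [one_zpow, mul_one])) (by
          show χ (x * y).2 = χ x.2 * χ y.2
          exact map_mul χ x.2 y.2))) }
    have hψ : ∀ x, (ψ x).val = ((1 : G), (⟨(x.1, 1), χ x.2⟩ : Dih E Fbar l)) := fun _ => rfl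
    refine isCyclic_of_surjective ((QuotientGroup.mk' _).comp ψ) ?_
    intro q
    obtain ⟨⟨x, hx⟩, rfl⟩ := QuotientGroup.mk_surjective q
    have hxg : x.2.left.2 ∈ Subgroup.zpowers g := (Dih.mem_dC_iff _ _).mp (mem_lift.mp hx)
    obtain ⟨a, ha⟩ := hχ x.2.right
    refine ⟨(x.2.left.1, a), ?_⟩
    rw [MonoidHom.comp_apply, QuotientGroup.mk'_apply, QuotientGroup.eq, Subgroup.mem_subgroupOf, piXarrow_eq]
    refine mem_lift.mpr ⟨?_, ?_, ?_⟩
    · show ((ψ (x.2.left.1, a)).val⁻¹ * x).2.right = 1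
      rw [hψ]
      show (⟨(x.2.left.1, 1), χ a⟩ : Dih E Fbar l)⁻¹.right * x.2.right = 1
      rw [SemidirectProduct.inv_right, ha, inv_mul_cancel]
    · show ((ψ (x.2.left.1, a)).val⁻¹ * x).2.left.1 = 1
      rw [← Dih.wCoord_apply, hψ]
      show Dih.wCoord E Fbar l ((⟨(x.2.left.1, 1), χ a⟩ : Dih E Fbar l)⁻¹ * x.2) = 1
      rw [map_mul, map_inv, Dih.wCoord_apply, Dih.wCoord_apply, inv_mul_cancel]
    · show ((ψ (x.2.left.1, a)).val⁻¹ * x).2.left.2 ∈ Subgroup.zpowers g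
      rw [hψ]
      show ((⟨(x.2.left.1, 1), χ a⟩ : Dih E Fbar l)⁻¹ * x.2).left.2 ∈ Subgroup.zpowers g
      rw [SemidirectProduct.mul_left, SemidirectProduct.inv_left, Prod.snd_mul, sgnN_apply, sgnN_apply]
      exact mul_mem (Subgroup.zpow_mem _ (by rw [Prod.snd_inv, inv_one]; exact one_mem _) _)
        (Subgroup.zpow_mem _ hxg _)
  galC_cyclic := by
    intro hN
    let ψ : Multiplicative (ZMod l) →* (pedOf G g h5 h6).PiCbar :=
      { toFun := fun w => ⟨((1 : G), (SemidirectProduct.inl (w, 1) : Dih E Fbar l)),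
          mem_lift.mpr ((Dih.mem_dC_iff _ _).mpr (one_mem _))⟩
        map_one' := rfl
        map_mul' := fun x y => Subtype.ext (Prod.ext (one_mul 1).symm (by
          show (SemidirectProduct.inl ((x * y, 1) : N E Fbar l) : Dih E Fbar l) =
            SemidirectProduct.inl (x, 1) * SemidirectProduct.inl (y, 1)
          rw [← map_mul, Prod.mk_mul_mk, mul_one])) }
    have hψ : ∀ w, (ψ w).val = ((1 : G), (SemidirectProduct.inl (w, 1) : Dih E Fbar l)) := fun _ => rfl
    refine isCyclic_of_surjective ((QuotientGroup.mk' _).comp ψ) ?_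
    intro q
    obtain ⟨⟨x, hx⟩, rfl⟩ := QuotientGroup.mk_surjective q
    have hxC : x.2 ∈ Dih.dC F E g := mem_lift.mp hx
    refine ⟨x.2.left.1, ?_⟩
    rw [MonoidHom.comp_apply, QuotientGroup.mk'_apply, QuotientGroup.eq, Subgroup.mem_subgroupOf, piCarrow_eq]
    refine mem_lift.mpr ((Dih.mem_dLinePM_iff _ _).mpr ⟨?_, ?_⟩)
    · show ((ψ x.2.left.1).val⁻¹ * x).2.left.2 ∈ Subgroup.zpowers g
      rw [hψ]
      show ((SemidirectProduct.inl ((x.2.left.1, 1) : N E Fbar l) : Dih E Fbar l)⁻¹ * x.2).left.2 ∈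
        Subgroup.zpowers g
      have h1 : (SemidirectProduct.inl ((x.2.left.1, 1) : N E Fbar l) : Dih E Fbar l)⁻¹ ∈ Dih.dC F E g := by
        rw [← map_inv, Dih.mem_dC_iff, SemidirectProduct.left_inl, Prod.snd_inv, inv_one]
        exact one_mem _
      exact (Dih.mem_dC_iff _ _).mp (mul_mem h1 hxC)
    · show ((ψ x.2.left.1).val⁻¹ * x).2.left.1 = 1
      rw [← Dih.wCoord_apply, hψ]
      show Dih.wCoord E Fbar l ((SemidirectProduct.inl ((x.2.left.1, 1) : N E Fbar l) : Dih E Fbar l)⁻¹ * x.2) = 1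
      rw [map_mul, map_inv, Dih.wCoord_apply, Dih.wCoord_apply, SemidirectProduct.left_inl, inv_mul_cancel]

end Claims

end TorsionClaimsModel

/-! ## At the re-geometrised initial Θ-datum `regeom₂`: the claims, `hI`, and the JOINT witness -/

namespace InitialThetaData

open TorsionMonodromyModel TorsionClaimsModel
open scoped WeierstrassCurve.Affine Classical

variable {F K Fbar : Type u} [Field F] [NumberField F] [Field K] [NumberField K] [Algebra F K] [Field Fbar]
  [Algebra F Fbar] [Algebra K Fbar] {E : WeierstrassCurve F} [E.IsElliptic] {l : ℕ} {Pb : BadPlacePredicates K}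

/-- `regeom₂` keeps `V^bad_mod`. [cite: Mochizuki2012, IUTchI Def 3.1 (b) p.61] -/
theorem regeom₂_VbadMod (D₀ : InitialThetaData F K Fbar E l Pb) : D₀.regeom₂.VbadMod = D₀.VbadMod := rfl

/-- `regeom₂` keeps `V̲`. [cite: Mochizuki2012, IUTchI Def 3.1 (e) p.62] -/
theorem regeom₂_V (D₀ : InitialThetaData F K Fbar E l Pb) : D₀.regeom₂.V = D₀.V := rfl

/-- **The printed §1 claims `ArrowCoveringClaims` HOLD at `regeom₂`** (its `K`-level datum is the claims model
`pedOf G_K g`). ([IUTchI] §1 p.38) [claim: Mochizuki2012, status: disputed] -/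
theorem arrowCoveringClaims_regeom₂ (D₀ : InitialThetaData F K Fbar E l Pb) :
    D₀.regeom₂.geom.pe.ArrowCoveringClaims := by
  haveI := D₀.isAlgClosure
  haveI := D₀.isScalarTower
  haveI : NeZero l := ⟨D₀.l_prime.ne_zero⟩
  haveI : CompactSpace (galoisSubgroupOf F K Fbar) :=
    isCompact_iff_compactSpace.mp (ThetaGeometryModel.isClosed_galoisSubgroupOf F K Fbar).isCompact
  exact arrowCoveringClaims_pedOf (galoisSubgroupOf F K Fbar) D₀.lineGen D₀.five_le_l
    (coprime_six_of_prime l D₀.l_prime D₀.five_le_l) D₀.l_prime D₀.card_tors_eq D₀.lineGen_ne_one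

/-- **The cusp inertia at `regeom₂` is NONTRIVIAL** (`I_{ε′} = G_K-free line `W` of order `l`) — in contrast with abc-iut-L5-t8's
`regeom` (`InitialThetaData.inertia_regeom_eq_bot`, p447268). ([IUTchI] §1 p.37) [claim: Mochizuki2012, status: disputed] -/
theorem inertia_ε1_regeom₂_ne_bot (D₀ : InitialThetaData F K Fbar E l Pb) :
    D₀.regeom₂.geom.pe.inertia D₀.regeom₂.geom.pe.ε1 ≠ ⊥ := by
  haveI := D₀.isAlgClosure
  haveI := D₀.isScalarTower
  haveI : NeZero l := ⟨D₀.l_prime.ne_zero⟩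
  haveI : CompactSpace (galoisSubgroupOf F K Fbar) :=
    isCompact_iff_compactSpace.mp (ThetaGeometryModel.isClosed_galoisSubgroupOf F K Fbar).isCompact
  exact inertia_ε1_ne_bot (galoisSubgroupOf F K Fbar) D₀.lineGen D₀.five_le_l
    (coprime_six_of_prime l D₀.l_prime D₀.five_le_l) D₀.l_prime

/-- **`hI` at `regeom₂` for the monodromy term `torsionMonodromyRegeom₂`**: `τ = pr_{E[l]}` kills `embK(I_x)` for EVERY cusp
label `x` (`I_x ⊆ 1 × dW`, whose `E_F[l]`-coordinate is trivial; `I_{2ε} = 1`) — the shape of abc-iut-L5-t8's v-next field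
`UnramifiedTorsionMonodromy.tau_inertia`, here with NONTRIVIAL inertia at `ε⁰, ε′, ε″`.
([IUTchI] §1 p.37) [claim: Mochizuki2012, status: disputed] -/
theorem tau_inertia_regeom₂ (D₀ : InitialThetaData F K Fbar E l Pb) (x : D₀.regeom₂.geom.pe.Cusp) :
    ∀ k ∈ D₀.regeom₂.geom.pe.inertia x, D₀.torsionMonodromyRegeom₂.tau (D₀.regeom₂.geom.embK k) = 0 := by
  haveI := D₀.isAlgClosure
  haveI := D₀.isScalarTower
  haveI : NeZero l := ⟨D₀.l_prime.ne_zero⟩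
  haveI : CompactSpace (galoisSubgroupOf F K Fbar) :=
    isCompact_iff_compactSpace.mp (ThetaGeometryModel.isClosed_galoisSubgroupOf F K Fbar).isCompact
  intro k hk
  change Tors.pt (TorsionClaimsModel.embK D₀.fixesTorsion_of_mem_galoisSubgroupOf k).left.2 = 0
  rw [TorsionClaimsModel.embK_left, Tors.pt_eq_zero_iff]
  by_cases hx : x = ⟨3⟩
  · subst hx
    have hk' : k ∈ (TorsionClaimsModel.pedOf (galoisSubgroupOf F K Fbar) D₀.lineGen D₀.five_le_l
        (coprime_six_of_prime l D₀.l_prime D₀.five_le_l)).inertia ⟨3⟩ := hk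
    have hk1 : k = 1 := Subgroup.mem_bot.mp
      ((inertia_twoε_eq_bot (galoisSubgroupOf F K Fbar) D₀.lineGen D₀.five_le_l
        (coprime_six_of_prime l D₀.l_prime D₀.five_le_l)).le hk')
    rw [hk1]
    rfl
  · have hk' := (mem_inertia_iff_of_ne (galoisSubgroupOf F K Fbar) D₀.lineGen D₀.five_le_l
      (coprime_six_of_prime l D₀.l_prime D₀.five_le_l) hx).mp hk
    exact hk'.2.2

/-- `hI` in the VERBATIM shape of abc-iut-L5-d5's binder (cusp label `ε′`).
([IUTchI] §1 p.37) [claim: Mochizuki2012, status: disputed] -/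
theorem hI_regeom₂ (D₀ : InitialThetaData F K Fbar E l Pb) :
    ∀ k ∈ D₀.regeom₂.geom.pe.inertia D₀.regeom₂.geom.pe.ε1,
      D₀.torsionMonodromyRegeom₂.tau (D₀.regeom₂.geom.embK k) = 0 :=
  D₀.tau_inertia_regeom₂ _

/-- **JOINT NON-VACUITY of the binder set `{M : TorsionMonodromy, hA : ArrowCoveringClaims, hI}`** of abc-iut-L5-d5's
derived local arrow law (`localArrowLaw_local_of_torsionMonodromy`, p446888) and abc-iut-L5-t4's genuine kit
(`baseKitOfTorsionMonodromy`, p446463): for every initial Θ-datum `D₀` there is one with the SAME arithmetic data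
(`V^bad_mod`, `V̲`) carrying a torsion monodromy `M` with the printed §1 claims AND `hI` — all at ONE datum
(`D := D₀.regeom₂`, `M := D₀.torsionMonodromyRegeom₂`).  Tag «[model: synthetic rank-1 inertia line, ι-fixed,
I_{ε′} = I_{ε″}; finite Δ_X; genuine Galois action on E_F[l]]»; inhabited ≠ discharged.
([IUTchI] Def 6.1 (v) p.158) [claim: Mochizuki2012, status: disputed] -/
theorem exists_torsionMonodromy_arrowCoveringClaims_hI (D₀ : InitialThetaData F K Fbar E l Pb) :
    ∃ D : InitialThetaData F K Fbar E l Pb, D.VbadMod = D₀.VbadMod ∧ D.V = D₀.V ∧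
      ∃ M : D.TorsionMonodromy, D.geom.pe.ArrowCoveringClaims ∧
        ∀ k ∈ D.geom.pe.inertia D.geom.pe.ε1, M.tau (D.geom.embK k) = 0 :=
  ⟨D₀.regeom₂, rfl, rfl, D₀.torsionMonodromyRegeom₂, D₀.arrowCoveringClaims_regeom₂, D₀.hI_regeom₂⟩

/-- The same witness with the stronger `tau_inertia` at EVERY cusp label and the non-triviality of `I_{ε′}` recorded
(so the witness is NOT the degenerate one of abc-iut-L5-t8's `regeom`). ([IUTchI] §1 p.37) [claim: Mochizuki2012, status: disputed] -/
theorem exists_torsionMonodromy_arrowCoveringClaims_tau_inertia (D₀ : InitialThetaData F K Fbar E l Pb) :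
    ∃ D : InitialThetaData F K Fbar E l Pb, D.VbadMod = D₀.VbadMod ∧ D.V = D₀.V ∧
      D.geom.pe.ArrowCoveringClaims ∧ D.geom.pe.inertia D.geom.pe.ε1 ≠ ⊥ ∧
      ∃ M : D.TorsionMonodromy, ∀ x : D.geom.pe.Cusp, ∀ k ∈ D.geom.pe.inertia x, M.tau (D.geom.embK k) = 0 :=
  ⟨D₀.regeom₂, rfl, rfl, D₀.arrowCoveringClaims_regeom₂, D₀.inertia_ε1_regeom₂_ne_bot, D₀.torsionMonodromyRegeom₂,
    D₀.tau_inertia_regeom₂⟩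

end InitialThetaData

end Literature.IUT.HodgeTheaters

end
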